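import Summits.HodgeConjecture.HodgeConjecture.Theses.TropicalCuspLift
import Literature.AlgebraicGeometry.HodgeTheory.WeilClassesFourfolds

/-!
# Route TropicalCuspLift · `WeilFourfoldsBase` (stmt-HodgeConjecture-2525) — the induction base

The support item `WeilFourfoldsBase` of route `route-HodgeConjecture-TropicalCuspLift` is the
thesis `X(n)` ("Weil classes are algebraic") at `n = 2`: for `d ≥ 1`, a complex abelian FOURFOLD
`A` (`A.dim = 2 * 2`, `IsSmoothProjective (2 * 2) A.X`) with `φ : A ⟶ A`, `φ ≫ φ = -(d • 𝟙 A)`,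
every rational class `c ∈ H⁴(A(ℂ); ℂ)` of Hodge type `(2,2)` of the form `c = c₁ + c₂`, `c₁ ∈ E₊`,
`c₂ ∈ E₋` (the two Weil eigen-lines, spelled out by the pull-backs `(x·𝟙 + y·φ)^*`), lies in
`algebraicClasses A.X 2`.

This is a THEOREM IN PRINT and nothing less: Markman 2025 (arXiv:2509.23403 Thm. 1.2, fourfold
half, with §11.5 Step 2 "Hence, the Weil classes are algebraic on every abelian fourfold";
arXiv:2502.03415 Cor. 1.6.1), whose proof (secant sheaves on `X × X̂`, hyperholomorphic sheaves on
generalised Kummers, Buchweitz–Flenner semiregularity, Schoen's product/degeneration argument) is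
far beyond the tree. The tree records it as the NAMED FACT
`Literature.AlgebraicGeometry.HodgeTheory.Markman2025_weilClasses_algebraic_abelianFourfold`
(file `Literature/AlgebraicGeometry/HodgeTheory/WeilClassesFourfolds.lean`), stated over the Weil
plane `weilClassesOf A φ 2 d = E₊ ⊔ E₋`.

What this file proves (sorry-free; the second theorem is CONDITIONAL on the named fact, by design
of the item — see its docstring in the route file: "typed so that … a Literature named fact … can
discharge it as a hypothesis"):

* `tropicalCuspLift_weilFourfoldsBase_iff_markman` — the item IS the named fact, verbatim up to
  `mem_weilClassesOf_iff` (the route inlines `c ∈ E₊ ⊔ E₋` as `∃ c₁ c₂, c = c₁ + c₂ ∧ …`). So the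
  item is exactly as strong as Markman's theorem: it closes unconditionally the day
  `Markman2025_weilClasses_algebraic_abelianFourfold_holds` lands, and not before.
* `tropicalCuspLift_weilFourfoldsBase_of_markman` — the conditional closure
  `Markman2025_weilClasses_algebraic_abelianFourfold → WeilFourfoldsBase`.

Upper bound / consistency (not restated here): the summit statement implies the named fact
(`Markman2025_weilClasses_algebraic_abelianFourfold_of_hodgeConjectureFor` in the Literature file),
hence the item, by the equivalence; and the route's target `WeilClassesAlgebraic` gives the item at
`n = 2` definitionally.
-/

noncomputable section

open CategoryTheory
open Literature.AlgebraicGeometry.Motives Literature.AlgebraicGeometry.HodgeTheory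
open Literature.AlgebraicTopology.SingularHomology

namespace Summit.HodgeConjecture.HodgeConjecture.Theorems

/-- **The induction base of `TropicalCuspLift` is Markman's theorem, verbatim.** The route decl
`WeilFourfoldsBase` (Weil-plane membership inlined as `c = c₁ + c₂`, `c₁ ∈ E₊`, `c₂ ∈ E₋`) is
equivalent to the named fact `Markman2025_weilClasses_algebraic_abelianFourfold` (membership in
`weilClassesOf A φ 2 d = E₊ ⊔ E₋`), by `mem_weilClassesOf_iff`. Markman, arXiv:2509.23403 Thm. 1.2:
"The Weil classes for abelian fourfolds of Weil type … are algebraic"; §11.5 Step 2: "Hence, the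
Weil classes are algebraic on every abelian fourfold."
[cite: Markman2025SurveySecant, Thm. 1.2 and §11.5 Step 2] -/
theorem tropicalCuspLift_weilFourfoldsBase_iff_markman :
    Theses.TropicalCuspLift.WeilFourfoldsBase ↔
      Markman2025_weilClasses_algebraic_abelianFourfold := by
  unfold Theses.TropicalCuspLift.WeilFourfoldsBase Markman2025_weilClasses_algebraic_abelianFourfold
  constructor
  · intro h d hd A φ hA hX hφ c hc h22 hW
    exact h d hd A φ hA hX hφ c hc h22 (mem_weilClassesOf_iff.1 hW)
  · intro h d hd A φ hA hX hφ c hc h22 hW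
    exact h d hd A φ hA hX hφ c hc h22 (mem_weilClassesOf_iff.2 hW)

/-- **Conditional closure of `WeilFourfoldsBase`**: granted Markman's theorem (the named fact
`Markman2025_weilClasses_algebraic_abelianFourfold`, undischarged in the tree — its proof needs
secant sheaves on abelian varieties, hyperholomorphic sheaves and Buchweitz–Flenner
semiregularity), the route's induction base holds. CONDITIONAL RESULT: the trust base is exactly
that one named fact. [cite: Markman2025SurveySecant, Thm. 1.2 and §11.5 Step 2]
[cite: Markman2025SecantWeil, Cor. 1.6.1 (proof)] -/
theorem tropicalCuspLift_weilFourfoldsBase_of_markman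
    (h : Markman2025_weilClasses_algebraic_abelianFourfold) :
    Theses.TropicalCuspLift.WeilFourfoldsBase :=
  tropicalCuspLift_weilFourfoldsBase_iff_markman.2 h

end Summit.HodgeConjecture.HodgeConjecture.Theorems

end
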